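import Mathlib
import Summits.CriticalPhenomena.CardyFormulaZ2.Theorems.CardySelfRefinementDefs
import Summits.CriticalPhenomena.CardyFormulaZ2.Theorems.CardySelfRefinementRussoDriftModel
import Summits.CriticalPhenomena.CardyFormulaZ2.Theorems.CardySelfRefinementRussoDriftPolynomial
import Summits.CriticalPhenomena.CardyFormulaZ2.Theorems.CardySelfRefinementTrivialSectorRateStubFourArmAboveOneCircuitBitsLocality
import Summits.CriticalPhenomena.CardyFormulaZ2.Theorems.CardySelfRefinementTrivialSectorRateStubSixArmDecayReimer
import Literature.Probability.LatticeModels.ProdBernoulliIndependence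
import Literature.Probability.LatticeModels.ProdBernoulliReimer
import HarnessLib

/-!
# Stub `stub_sixArmDecay` of line `far-field-is-a-quarter-turn` (crux `TrivialSectorRate`,
stmt-CriticalPhenomena-10266): THE SIXTH-ARM SUB-MULTIPLICATIVITY `hR'` IS NOT A REIMER
INEQUALITY FOR `M_k` — TWO CLOSED SUB-EDGES OF ONE BUNDLE CANNOT BE SPLIT, UNDER ANY READ-OUT

The sub-multiplicativity hypothesis `hR'` of `sixArmDecayAlong_of_fiveArm_subMult`
(`…StubSixArmDecaySixthArm.lean`: six arms across `c + A_{m,n}` cost at most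
`C · M_k(five arms) · M_k(closed dual arm)` on comparable sub-annuli) is, in print, Reimer's
inequality `𝒜₆ ⊆ 𝒜₅ □ 𝒜₁`.  For `M_k = (coin product).map (read-out)` Reimer's inequality holds
on the COIN space (`prodBernoulli_reimer_local`) for ANY measurable read-out `rd` of the coins
with law `M_k` (`real_le_mul_of_ae_mem_disjointOccurrence`, the form used with the second
read-out `exists_readout` in `M_real_setOf_le_numCrossingClusters_le_pow`), so `hR'` would follow
from an almost-sure inclusion `rd ⁻¹' six ⊆ (rd ⁻¹' five) □ (rd ⁻¹' dual)` for SOME read-out.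
This file proves that the atomic step such an inclusion needs in rigid geometries is impossible
for every read-out.  Let `e₀ = edgeOf (0, 0)`, `e₁ = edgeOf (e⃗₀, 0)` be the first two sub-edges
of the bundle (coarse edge) at the origin, `k ≥ 2`.

* `M_real_closed_fst`, `M_real_closed_snd`, `M_real_closed_pair`, `mul_lt_M_real_closed_pair` —
  under `M_k(ρ,c)` each of `e₀`, `e₁` is closed with probability `½`, both with probability
  `½ ρ̂ + ¼ (1 - ρ̂) = ¼ + ¼ ρ̂ > ¼` for `ρ > 0` (`ρ̂ = ρ` clamped to `[0,1]`): strict positive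
  association of the closed sub-edges of a bundle (the quantitative form of the remark after
  `M_real_le_mul_of_coinDisjoint_witnesses`);
* `real_le_mul_of_ae_mem_disjointOccurrence` — Reimer for `M_k` through an arbitrary read-out;
* **`not_ae_mem_disjointOccurrence_closed_subEdges`** (registered helper) — for EVERY measurable
  read-out `rd` with law `M_k(q)`, `q.1 > 0`, under which the two one-edge events pull back to
  local coin events, the coin configurations reading "`e₀`, `e₁` closed" are NOT almost surely in
  `(rd ⁻¹' {e₀ closed}) □ (rd ⁻¹' {e₁ closed})` (else Reimer would give `¼ + ¼ ρ̂ ≤ ¼`): a set of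
  positive measure has no disjoint certificates for the two closednesses;
  `not_ae_mem_disjointOccurrence_closed_subEdges_cfg` is the instance for the route's `cfg k`
  (bad set `{selector on, shared coin off}`: both closednesses then need the shared coin).

Why this kills the Reimer route to `hR'` for `k = 3` AND `k = 2` (planar part, not formalised).
`k = 3`: the three-corridor configuration of `…SixthArm.lean` forces the five-arm witness to
certify two closed rungs and the dual witness the third closed rung of ONE bundle on every axial
row of the common radial range.  `k = 2` (left open there): in `c + A_{m,n}` open the columns
`x = 1`, `x = 3` (rows `m … n`; non-axial for `k = 2`) and every annulus edge off the strip
`1 ≤ x ≤ 3`, close the rest, except two branches on even rows `y₁ ≠ y₂` of the common range: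
`(2,y₁)–(3,y₁)` and `(1,y₂)–(2,y₂)` open.  Crossing clusters: column `1`, column `3`, the rest;
dual corridors: `x = ½` (rungs `(0,y)–(1,y) = e₀((0,y/2),0)`), `x = 3½` (rungs
`(3,y)–(4,y) = e₁((1,y/2),0)`), and the middle one, pinched at row `y₁` to the single edge
`(1,y₁)–(2,y₁) = e₁((0,y₁/2),0)` and at row `y₂` to `(2,y₂)–(3,y₂) = e₀((1,y₂/2),0)`.  A
five-arm cylinder witness contains dual crossings of two corridors, a dual-arm witness one of
the third, so whichever corridor the dual arm takes, the pair certifies SEPARATELY the two closed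
sub-edges of `((0,y₁/2),0)` or of `((1,y₂/2),0)` (their states read only that bundle's coins,
so the witnesses restrict to the bundle) — impossible on a set of positive conditional measure
by this file, for every read-out of the bundle from private coins (for `cfg k` and the second
read-out: whenever that selector is on).  So for both `k` the coin-level inclusion behind `hR'`
fails with positive `M_k`-probability at every parameter point `0 < ρ < 1`, `0 < c < 1`,
whatever the read-out: the second read-out makes OPEN crossings of distinct clusters coin-disjoint
(`k ≤ 3`), but one shared coin closes `k` sub-edges whose DUAL edges are pairwise non-adjacent,
so distinct closed dual arms may need the same coin.  Consequence: `hR'` and the sixth-arm price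
(S6) of `sixArmDecayAlong_of_fiveArm` (statements about total masses, presumably true) need
arm separation for `M_k` (Kesten 1987; Nolin 2008, §4), like the five-arm bound (S5); no
witness/Reimer argument delivers them.

References: D. Reimer, Combin. Probab. Comput. 9 (2000); G. Grimmett, *Percolation* (1999),
§2.3; H. Kesten, Comm. Math. Phys. 109 (1987); P. Nolin, Electron. J. Probab. 13 (2008), §4.

Target file:
`Summits/CriticalPhenomena/CardyFormulaZ2/Theorems/CardySelfRefinementTrivialSectorRateStubSixArmDecaySubMultObstruction.lean`.
-/

noncomputable section

namespace Summit.CriticalPhenomena.CardyFormulaZ2.Theorems.CardySelfRefinement.FarField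

open Set MeasureTheory
open Literature.Probability.LatticeModels Literature.Probability.Percolation
open Literature.Probability.Percolation.QuadCrossing
open Summit.CriticalPhenomena.CardyFormulaZ2.Theses.CardySelfRefinement

/-! ### Reimer's inequality for `M_k` through an arbitrary read-out -/

/-- **Reimer's inequality for `M_k` through an arbitrary read-out of the coins.**  Let `rd` be
a measurable map from coin configurations to bond configurations whose law under the coin
product `coinLaw k q` is `M_k(q)` (e.g. `cfg k`, or the second read-out of `exists_readout`).
If the pull-backs of the measurable events `A`, `B` are local coin events and the pull-back of
the measurable event `E` lies almost surely in their coin-space disjoint occurrence, then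
`M_k(q)(E) ≤ M_k(q)(A) · M_k(q)(B)` (`prodBernoulli_reimer_local`). -/
theorem real_le_mul_of_ae_mem_disjointOccurrence {k : ℕ} (q : ℝ × ℝ)
    {rd : Set Coin → Set (Sym2 (Site 2))} (hrd : Measurable rd)
    (hlaw : (coinLaw k q).map rd = M k q.1 q.2) {E A B : Set (BondConfig (Site 2))}
    (hE : MeasurableSet E) (hA : MeasurableSet A) (hB : MeasurableSet B)
    (hAl : IsLocalEvent (rd ⁻¹' A)) (hBl : IsLocalEvent (rd ⁻¹' B))
    (h : ∀ᵐ S ∂(coinLaw k q), S ∈ rd ⁻¹' E → S ∈ (rd ⁻¹' A) □ (rd ⁻¹' B)) :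
    (M k q.1 q.2).real E ≤ (M k q.1 q.2).real A * (M k q.1 q.2).real B := by
  haveI : IsProbabilityMeasure (coinLaw k q) := by
    change IsProbabilityMeasure (prodBernoulli (prm k q.1 q.2)); infer_instance
  rw [← hlaw, map_measureReal_apply hrd hE, map_measureReal_apply hrd hA,
    map_measureReal_apply hrd hB]
  calc (coinLaw k q).real (rd ⁻¹' E) ≤ (coinLaw k q).real ((rd ⁻¹' A) □ (rd ⁻¹' B)) :=
        ENNReal.toReal_mono (measure_ne_top _ _) (measure_mono_ae h)
    _ ≤ (coinLaw k q).real (rd ⁻¹' A) * (coinLaw k q).real (rd ⁻¹' B) :=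
        prodBernoulli_reimer_local (prm k q.1 q.2) hAl hBl

/-- **The contrapositive**: a strict defect `M_k(A) · M_k(B) < M_k(E)` rules out, for every
read-out `rd` with law `M_k` and local pull-backs of `A`, `B`, the almost-sure inclusion of
`rd ⁻¹' E` in `(rd ⁻¹' A) □ (rd ⁻¹' B)`: a set of coin configurations of positive measure
reads `E` without disjoint certificates for `A` and `B`. -/
theorem not_ae_mem_disjointOccurrence_of_mul_lt {k : ℕ} (q : ℝ × ℝ)
    {rd : Set Coin → Set (Sym2 (Site 2))} (hrd : Measurable rd)
    (hlaw : (coinLaw k q).map rd = M k q.1 q.2) {E A B : Set (BondConfig (Site 2))}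
    (hE : MeasurableSet E) (hA : MeasurableSet A) (hB : MeasurableSet B)
    (hAl : IsLocalEvent (rd ⁻¹' A)) (hBl : IsLocalEvent (rd ⁻¹' B))
    (hlt : (M k q.1 q.2).real A * (M k q.1 q.2).real B < (M k q.1 q.2).real E) :
    ¬ (∀ᵐ S ∂(coinLaw k q), S ∈ rd ⁻¹' E → S ∈ (rd ⁻¹' A) □ (rd ⁻¹' B)) :=
  fun h => (not_le.2 hlt) (real_le_mul_of_ae_mem_disjointOccurrence q hrd hlaw hE hA hB hAl hBl h)

/-! ### The first two sub-edges of the bundle at the origin: read-out and coins -/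

/-- A lattice edge `edgeOf vd` is open in `cfg k S` iff its read-out `opn k S vd` holds. -/
theorem edgeOf_mem_cfg_iff (k : ℕ) (S : Set Coin) (vd : Site 2 × Fin 2) :
    edgeOf vd ∈ cfg k S ↔ opn k S vd := by
  refine ⟨?_, fun h => ⟨vd.1, vd.2, rfl, h⟩⟩
  rintro ⟨v', d', he, hopn⟩
  obtain rfl : vd = (v', d') := edgeOf_injective (a₁ := vd) (a₂ := (v', d')) he
  exact hopn

/-- The coarse base of an edge based at the origin is the origin. -/
theorem tb_zero (k : ℕ) (d : Fin 2) : tb k ((0 : Site 2), d) = 0 := by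
  funext i
  simp [tb]

/-- For `k ≥ 2` the second sub-edge `(e⃗₀, 0)` of the bundle at the origin has coarse base the
origin too (for `k = 1` it would be its own bundle). -/
theorem tb_dirVec_zero {k : ℕ} (hk : 2 ≤ k) : tb k (dirVec 0, (0 : Fin 2)) = 0 := by
  have hk' : (2 : ℤ) ≤ k := by exact_mod_cast hk
  funext i
  show dirVec 0 i / (k : ℤ) = 0
  by_cases hi : i = 0
  · subst hi
    rw [dirVec_apply_self]
    exact Int.ediv_eq_zero_of_lt (by norm_num) (by omega)
  · simp [dirVec_apply_of_ne hi]

/-- Read-out of the first sub-edge `e₀ = edgeOf (0, 0)` of the bundle at the origin: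
(selector on and shared coin on) or (selector off and own coin on). -/
theorem opn_origin_iff (k : ℕ) (S : Set Coin) :
    opn k S ((0 : Site 2), (0 : Fin 2)) ↔
      ((((0 : Site 2), (0 : Fin 2), (2 : Fin 3)) ∈ S ∧ ((0 : Site 2), (0 : Fin 2), (1 : Fin 3)) ∈ S) ∨
        (((0 : Site 2), (0 : Fin 2), (2 : Fin 3)) ∉ S ∧ ((0 : Site 2), (0 : Fin 2), (0 : Fin 3)) ∈ S)) := by
  have hax : ax k ((0 : Site 2), (0 : Fin 2)) := by simp [ax]
  simp only [opn, if_pos hax, tb_zero]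

/-- Read-out of the second sub-edge `e₁ = edgeOf (e⃗₀, 0)` of the bundle at the origin
(`k ≥ 2`): (selector on and shared coin on) or (selector off and its own coin on); it reads the
SAME selector and shared coin as `e₀`. -/
theorem opn_dirVec_iff {k : ℕ} (hk : 2 ≤ k) (S : Set Coin) :
    opn k S (dirVec 0, (0 : Fin 2)) ↔
      ((((0 : Site 2), (0 : Fin 2), (2 : Fin 3)) ∈ S ∧ ((0 : Site 2), (0 : Fin 2), (1 : Fin 3)) ∈ S) ∨
        (((0 : Site 2), (0 : Fin 2), (2 : Fin 3)) ∉ S ∧ (dirVec 0, (0 : Fin 2), (0 : Fin 3)) ∈ S)) := by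
  have hax : ax k (dirVec 0, (0 : Fin 2)) := by
    show (k : ℤ) ∣ dirVec 0 (if (0 : Fin 2) = 0 then 1 else 0)
    rw [if_pos rfl, dirVec_apply_of_ne (show (1 : Fin 2) ≠ 0 by decide)]
    exact dvd_zero _
  simp only [opn, if_pos hax, tb_dirVec_zero hk]

/-- Pull-back of "`e₀` closed": (selector on, shared coin off) or (selector off, own coin off). -/
theorem preimage_cfg_closed_fst (k : ℕ) :
    cfg k ⁻¹' {ω | edgeOf ((0 : Site 2), (0 : Fin 2)) ∉ ω} =
      {S | ((0 : Site 2), (0 : Fin 2), (2 : Fin 3)) ∈ S ∧ ((0 : Site 2), (0 : Fin 2), (1 : Fin 3)) ∉ S} ∪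
      {S | ((0 : Site 2), (0 : Fin 2), (2 : Fin 3)) ∉ S ∧ ((0 : Site 2), (0 : Fin 2), (0 : Fin 3)) ∉ S} := by
  ext S
  rw [mem_preimage, mem_setOf_eq, edgeOf_mem_cfg_iff, opn_origin_iff]
  simp only [mem_union, mem_setOf_eq]
  tauto

/-- Pull-back of "`e₁` closed" (`k ≥ 2`): (selector on, shared off) or (selector off, own off). -/
theorem preimage_cfg_closed_snd {k : ℕ} (hk : 2 ≤ k) :
    cfg k ⁻¹' {ω | edgeOf (dirVec 0, (0 : Fin 2)) ∉ ω} =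
      {S | ((0 : Site 2), (0 : Fin 2), (2 : Fin 3)) ∈ S ∧ ((0 : Site 2), (0 : Fin 2), (1 : Fin 3)) ∉ S} ∪
      {S | ((0 : Site 2), (0 : Fin 2), (2 : Fin 3)) ∉ S ∧ (dirVec 0, (0 : Fin 2), (0 : Fin 3)) ∉ S} := by
  ext S
  rw [mem_preimage, mem_setOf_eq, edgeOf_mem_cfg_iff, opn_dirVec_iff hk]
  simp only [mem_union, mem_setOf_eq]
  tauto

/-- Pull-back of "`e₀`, `e₁` closed" (`k ≥ 2`): (selector on, shared off) or (selector off, both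
own coins off). -/
theorem preimage_cfg_closed_pair {k : ℕ} (hk : 2 ≤ k) :
    cfg k ⁻¹' {ω | edgeOf ((0 : Site 2), (0 : Fin 2)) ∉ ω ∧ edgeOf (dirVec 0, (0 : Fin 2)) ∉ ω} =
      {S | ((0 : Site 2), (0 : Fin 2), (2 : Fin 3)) ∈ S ∧ ((0 : Site 2), (0 : Fin 2), (1 : Fin 3)) ∉ S} ∪
      {S | ((0 : Site 2), (0 : Fin 2), (2 : Fin 3)) ∉ S ∧
        ((0 : Site 2), (0 : Fin 2), (0 : Fin 3)) ∉ S ∧ (dirVec 0, (0 : Fin 2), (0 : Fin 3)) ∉ S} := by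
  ext S
  rw [mem_preimage, mem_setOf_eq, edgeOf_mem_cfg_iff, edgeOf_mem_cfg_iff, opn_origin_iff,
    opn_dirVec_iff hk]
  simp only [mem_union, mem_setOf_eq]
  tauto

/-! ### Coin probabilities -/

/-- The coordinate events `{S | i ∈ S}`, `{S | i ∉ S}` are determined by `{i}`. -/
theorem determinedBy_setOf_mem_singleton (i : Coin) :
    DeterminedBy {S : Set Coin | i ∈ S} (↑({i} : Finset Coin) : Set Coin) ∧
      DeterminedBy {S : Set Coin | i ∉ S} (↑({i} : Finset Coin) : Set Coin) := by
  rw [determinedBy_iff, determinedBy_iff]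
  have key : ∀ S S' : Set Coin, S ∩ (↑({i} : Finset Coin) : Set Coin) = S' ∩ ↑({i} : Finset Coin) →
      (i ∈ S ↔ i ∈ S') := fun S S' h => by
    simpa only [Finset.coe_singleton, mem_inter_iff, mem_singleton_iff, and_true] using Set.ext_iff.1 h i
  exact ⟨key, fun S S' h => not_congr (key S S' h)⟩

/-- The event `{S | i ∉ S ∧ j ∉ S}` is determined by `{i, j}`. -/
theorem determinedBy_setOf_notMem_pair (i j : Coin) :
    DeterminedBy {S : Set Coin | i ∉ S ∧ j ∉ S} (↑({i, j} : Finset Coin) : Set Coin) := by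
  rw [determinedBy_iff]
  intro S S' h
  have hi := Set.ext_iff.1 h i
  have hj := Set.ext_iff.1 h j
  simp only [Finset.coe_insert, Finset.coe_singleton, mem_inter_iff, mem_insert_iff,
    mem_singleton_iff, true_or, or_true, and_true] at hi hj
  simp only [mem_setOf_eq]
  rw [hi, hj]

/-- `P(i ∈ S ∧ j ∉ S) = p i · (1 - p j)` for distinct coins. -/
theorem coinLaw_real_mem_and_notMem (p : Coin → unitInterval) {i j : Coin} (hij : i ≠ j) :
    (prodBernoulli p).real {S | i ∈ S ∧ j ∉ S} = p i * (1 - p j) := by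
  have h := prodBernoulli_real_inter_of_determinedBy_disjoint p (F := {i}) (F' := {j})
    (Finset.disjoint_singleton.2 hij) (determinedBy_setOf_mem_singleton i).1
    (determinedBy_setOf_mem_singleton j).2 (measurableSet_mem i) (measurableSet_notMem j)
  rw [prodBernoulli_real_setOf_mem, prodBernoulli_real_setOf_notMem] at h
  rw [← h]
  rfl

/-- `P(i ∉ S ∧ j ∉ S) = (1 - p i) · (1 - p j)` for distinct coins. -/
theorem coinLaw_real_notMem_and_notMem (p : Coin → unitInterval) {i j : Coin} (hij : i ≠ j) :
    (prodBernoulli p).real {S | i ∉ S ∧ j ∉ S} = (1 - p i) * (1 - p j) := by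
  have h := prodBernoulli_real_forall_notMem p {i, j}
  rw [Finset.prod_pair hij] at h
  rw [← h]
  congr 1
  ext S
  simp

/-- `P(i ∉ S ∧ j ∉ S ∧ l ∉ S) = (1 - p i) · (1 - p j) · (1 - p l)` for distinct coins. -/
theorem coinLaw_real_notMem_three (p : Coin → unitInterval) {i j l : Coin} (hij : i ≠ j)
    (hil : i ≠ l) (hjl : j ≠ l) :
    (prodBernoulli p).real {S | i ∉ S ∧ j ∉ S ∧ l ∉ S} = (1 - p i) * ((1 - p j) * (1 - p l)) := by
  have hd : Disjoint ({i} : Finset Coin) {j, l} := by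
    rw [Finset.disjoint_singleton_left]
    simp [hij, hil]
  have h := prodBernoulli_real_inter_of_determinedBy_disjoint p (F := {i}) (F' := {j, l}) hd
    (determinedBy_setOf_mem_singleton i).2 (determinedBy_setOf_notMem_pair j l)
    (measurableSet_notMem i) ((measurableSet_notMem j).inter (measurableSet_notMem l))
  rw [prodBernoulli_real_setOf_notMem, coinLaw_real_notMem_and_notMem p hjl] at h
  rw [← h]
  rfl

/-! ### The law of the two sub-edges under `M_k` -/

/-- The four coins (selector, shared, own of `e₀`, own of `e₁`) are pairwise distinct where
needed. -/
theorem bundle_coins_ne :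
    (((0 : Site 2), (0 : Fin 2), (2 : Fin 3)) : Coin) ≠ ((0 : Site 2), (0 : Fin 2), (1 : Fin 3)) ∧
    (((0 : Site 2), (0 : Fin 2), (2 : Fin 3)) : Coin) ≠ ((0 : Site 2), (0 : Fin 2), (0 : Fin 3)) ∧
    (((0 : Site 2), (0 : Fin 2), (2 : Fin 3)) : Coin) ≠ (dirVec 0, (0 : Fin 2), (0 : Fin 3)) ∧
    (((0 : Site 2), (0 : Fin 2), (0 : Fin 3)) : Coin) ≠ (dirVec 0, (0 : Fin 2), (0 : Fin 3)) := by
  refine ⟨ne_of_apply_ne (fun x => x.2.2) (by decide), ne_of_apply_ne (fun x => x.2.2) (by decide),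
    ne_of_apply_ne (fun x => x.2.2) (by decide), ne_of_apply_ne (fun x => x.1 0) ?_⟩
  show (0 : ℤ) ≠ dirVec 0 0
  rw [dirVec_apply_self]
  exact zero_ne_one

/-- The clamped selector bias `ρ̂ = projIcc 0 1 ρ`, as a real number in `[0,1]`, is positive
when `ρ` is. -/
theorem projIcc_pos {ρ : ℝ} (hρ : 0 < ρ) : 0 < ((Set.projIcc (0 : ℝ) 1 zero_le_one ρ : unitInterval) : ℝ) := by
  rw [Set.coe_projIcc]
  exact lt_max_of_lt_right (lt_min zero_lt_one hρ)

/-- The biases of the four coins read by `e₀`, `e₁`: selector `ρ̂`, shared coin `½`, own coins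
`½` (both sub-edges are axial). -/
theorem prm_bundle_coins (k : ℕ) (ρ c : ℝ) :
    prm k ρ c ((0 : Site 2), (0 : Fin 2), (2 : Fin 3)) = Set.projIcc (0 : ℝ) 1 zero_le_one ρ ∧
    prm k ρ c ((0 : Site 2), (0 : Fin 2), (1 : Fin 3)) = half ∧
    prm k ρ c ((0 : Site 2), (0 : Fin 2), (0 : Fin 3)) = half ∧
    prm k ρ c (dirVec 0, (0 : Fin 2), (0 : Fin 3)) = half := by
  have hax0 : ax k ((0 : Site 2), (0 : Fin 2)) := by simp [ax]
  have hax1 : ax k (dirVec 0, (0 : Fin 2)) := by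
    show (k : ℤ) ∣ dirVec 0 (if (0 : Fin 2) = 0 then 1 else 0)
    rw [if_pos rfl, dirVec_apply_of_ne (show (1 : Fin 2) ≠ 0 by decide)]
    exact dvd_zero _
  exact ⟨by simp [prm], by simp [prm], by simp [prm, hax0], by simp [prm, hax1]⟩

/-- **`M_k(ρ,c)(e₀ closed) = ½`.** -/
theorem M_real_closed_fst (k : ℕ) (ρ c : ℝ) :
    (M k ρ c).real {ω | edgeOf ((0 : Site 2), (0 : Fin 2)) ∉ ω} = 1 / 2 := by
  obtain ⟨hsel, hsh, hown0, -⟩ := prm_bundle_coins k ρ c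
  obtain ⟨hne21, hne20, -, -⟩ := bundle_coins_ne
  rw [map_measureReal_apply (measurable_cfg k) (measurableSet_notMem _), preimage_cfg_closed_fst,
    measureReal_union ?_ ?_, coinLaw_real_mem_and_notMem _ hne21, coinLaw_real_notMem_and_notMem _ hne20,
    hsel, hsh, hown0, coe_half]
  · ring
  · exact Set.disjoint_left.2 fun S h1 h2 => h2.1 h1.1
  · exact (measurableSet_notMem _).inter (measurableSet_notMem _)

/-- **`M_k(ρ,c)(e₁ closed) = ½`** (`k ≥ 2`). -/
theorem M_real_closed_snd {k : ℕ} (hk : 2 ≤ k) (ρ c : ℝ) :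
    (M k ρ c).real {ω | edgeOf (dirVec 0, (0 : Fin 2)) ∉ ω} = 1 / 2 := by
  obtain ⟨hsel, hsh, -, hown1⟩ := prm_bundle_coins k ρ c
  obtain ⟨hne21, -, hne2d, -⟩ := bundle_coins_ne
  rw [map_measureReal_apply (measurable_cfg k) (measurableSet_notMem _), preimage_cfg_closed_snd hk,
    measureReal_union ?_ ?_, coinLaw_real_mem_and_notMem _ hne21, coinLaw_real_notMem_and_notMem _ hne2d,
    hsel, hsh, hown1, coe_half]
  · ring
  · exact Set.disjoint_left.2 fun S h1 h2 => h2.1 h1.1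
  · exact (measurableSet_notMem _).inter (measurableSet_notMem _)

/-- **`M_k(ρ,c)(e₀ and e₁ closed) = ½ ρ̂ + ¼ (1 - ρ̂)`** (`k ≥ 2`): with probability `ρ̂` the
selector is on and both sub-edges read the shared coin, otherwise they read two independent fair
coins. -/
theorem M_real_closed_pair {k : ℕ} (hk : 2 ≤ k) (ρ c : ℝ) :
    (M k ρ c).real {ω | edgeOf ((0 : Site 2), (0 : Fin 2)) ∉ ω ∧ edgeOf (dirVec 0, (0 : Fin 2)) ∉ ω} =
      1 / 2 * ((Set.projIcc (0 : ℝ) 1 zero_le_one ρ : unitInterval) : ℝ) +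
        1 / 4 * (1 - ((Set.projIcc (0 : ℝ) 1 zero_le_one ρ : unitInterval) : ℝ)) := by
  obtain ⟨hsel, hsh, hown0, hown1⟩ := prm_bundle_coins k ρ c
  obtain ⟨hne21, hne20, hne2d, hne0d⟩ := bundle_coins_ne
  have hmeas : MeasurableSet
      {ω : BondConfig (Site 2) | edgeOf ((0 : Site 2), (0 : Fin 2)) ∉ ω ∧ edgeOf (dirVec 0, (0 : Fin 2)) ∉ ω} :=
    (measurableSet_notMem _).inter (measurableSet_notMem _)
  rw [map_measureReal_apply (measurable_cfg k) hmeas, preimage_cfg_closed_pair hk,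
    measureReal_union ?_ ?_, coinLaw_real_mem_and_notMem _ hne21,
    coinLaw_real_notMem_three _ hne20 hne2d hne0d, hsel, hsh, hown0, hown1, coe_half]
  · ring
  · exact Set.disjoint_left.2 fun S h1 h2 => h2.1 h1.1
  · exact (measurableSet_notMem _).inter ((measurableSet_notMem _).inter (measurableSet_notMem _))

/-- **Strict positive association of the closed sub-edges of a bundle**: for `ρ > 0` (and
`k ≥ 2`), `M_k(ρ,c)(e₀ closed) · M_k(ρ,c)(e₁ closed) = ¼ < ¼ + ¼ ρ̂ = M_k(ρ,c)(e₀, e₁ closed)`. -/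
theorem mul_lt_M_real_closed_pair {k : ℕ} (hk : 2 ≤ k) {ρ : ℝ} (hρ : 0 < ρ) (c : ℝ) :
    (M k ρ c).real {ω | edgeOf ((0 : Site 2), (0 : Fin 2)) ∉ ω} *
        (M k ρ c).real {ω | edgeOf (dirVec 0, (0 : Fin 2)) ∉ ω} <
      (M k ρ c).real {ω | edgeOf ((0 : Site 2), (0 : Fin 2)) ∉ ω ∧ edgeOf (dirVec 0, (0 : Fin 2)) ∉ ω} := by
  rw [M_real_closed_fst, M_real_closed_snd hk, M_real_closed_pair hk]
  have := projIcc_pos hρ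
  linarith

/-! ### No read-out splits the two closed sub-edges -/

/-- **NO READ-OUT OF THE COINS SPLITS TWO CLOSED SUB-EDGES OF ONE BUNDLE** (registered helper of
the stub `stub_sixArmDecay`; the obstruction to the Reimer route for its input `hR'`).  For
`k ≥ 2`, `q.1 > 0` and ANY measurable read-out `rd` of the coins with law `M_k(q)` under which
"`e₀` closed", "`e₁` closed" (the first two sub-edges of the bundle at the origin) pull back to
local coin events, it is NOT the case that almost every coin configuration reading both closed
lies in `(rd ⁻¹' {e₀ closed}) □ (rd ⁻¹' {e₁ closed})`: else Reimer on the coin space would give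
`M(e₀, e₁ closed) ≤ M(e₀ closed) M(e₁ closed) = ¼`, contradicting `mul_lt_M_real_closed_pair`.
(Witness pairs for (five arms, dual arm) in the rigid geometries of the module docstring restrict
to such a split.) -/
theorem not_ae_mem_disjointOccurrence_closed_subEdges : ∀ k : ℕ, 2 ≤ k → ∀ q : ℝ × ℝ, 0 < q.1 →
    ∀ rd : Set Coin → Set (Sym2 (Site 2)), Measurable rd → (coinLaw k q).map rd = M k q.1 q.2 →
    IsLocalEvent (rd ⁻¹' {ω | edgeOf ((0 : Site 2), (0 : Fin 2)) ∉ ω}) →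
    IsLocalEvent (rd ⁻¹' {ω | edgeOf (dirVec 0, (0 : Fin 2)) ∉ ω}) →
    ¬ (∀ᵐ S ∂(coinLaw k q),
        S ∈ rd ⁻¹' {ω | edgeOf ((0 : Site 2), (0 : Fin 2)) ∉ ω ∧ edgeOf (dirVec 0, (0 : Fin 2)) ∉ ω} →
        S ∈ disjointOccurrence (rd ⁻¹' {ω | edgeOf ((0 : Site 2), (0 : Fin 2)) ∉ ω})
          (rd ⁻¹' {ω | edgeOf (dirVec 0, (0 : Fin 2)) ∉ ω})) := by
  intro k hk q hq rd hrd hlaw hAl hBl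
  exact not_ae_mem_disjointOccurrence_of_mul_lt q hrd hlaw
    ((measurableSet_notMem _).inter (measurableSet_notMem _)) (measurableSet_notMem _)
    (measurableSet_notMem _) hAl hBl (mul_lt_M_real_closed_pair hk hq q.2)

/-- A one-edge event `{ω | e ∉ ω}` is determined by `{e}`. -/
theorem determinedBy_setOf_edge_notMem (e : Sym2 (Site 2)) :
    DeterminedBy {ω : BondConfig (Site 2) | e ∉ ω} ({e} : Set (Sym2 (Site 2))) := by
  rw [determinedBy_iff]
  intro ω ω' h
  have he := Set.ext_iff.1 h e
  simp only [mem_inter_iff, mem_singleton_iff, and_true] at he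
  exact not_congr he

/-- **The instance for the route's read-out `cfg k`**: for `k ≥ 2` and `ρ > 0`, the coin
configurations reading `e₀`, `e₁` closed through `cfg k` are not almost surely in
`(cfg k ⁻¹' {e₀ closed}) □ (cfg k ⁻¹' {e₁ closed})` (explicitly, the bad set is
`{selector on, shared coin off}`, of mass `½ ρ̂`: both closednesses then need the shared coin). -/
theorem not_ae_mem_disjointOccurrence_closed_subEdges_cfg {k : ℕ} (hk : 2 ≤ k) {ρ : ℝ} (hρ : 0 < ρ)
    (c : ℝ) :
    ¬ (∀ᵐ S ∂(prodBernoulli (prm k ρ c)),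
        S ∈ cfg k ⁻¹' {ω | edgeOf ((0 : Site 2), (0 : Fin 2)) ∉ ω ∧ edgeOf (dirVec 0, (0 : Fin 2)) ∉ ω} →
        S ∈ (cfg k ⁻¹' {ω | edgeOf ((0 : Site 2), (0 : Fin 2)) ∉ ω}) □
          (cfg k ⁻¹' {ω | edgeOf (dirVec 0, (0 : Fin 2)) ∉ ω})) :=
  not_ae_mem_disjointOccurrence_closed_subEdges k hk (ρ, c) hρ (cfg k) (measurable_cfg k) rfl
    (isLocalEvent_preimage_cfg k (Set.finite_singleton _) (determinedBy_setOf_edge_notMem _))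
    (isLocalEvent_preimage_cfg k (Set.finite_singleton _) (determinedBy_setOf_edge_notMem _))

end Summit.CriticalPhenomena.CardyFormulaZ2.Theorems.CardySelfRefinement.FarField

end
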